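import Summits.CriticalPhenomena.CardyFormulaZ2.Theorems.CardyComplexConeEdgeCoherenceStubAliasing
import Summits.CriticalPhenomena.CardyFormulaZ2.Theorems.CardyComplexConeCoherentMorera
import Literature.Probability.Percolation.FourArmGarbanCrossingEvent
import Literature.Probability.LatticeModels.MeshApproximatesPolyomino
import Literature.Probability.LatticeModels.MedialWindingBridge

/-!
# The harmonic split of the crux `CardyComplexCone.EdgeCoherence` (stmt-CriticalPhenomena-11385)

Crux strategist `planner-cstrat-stmt-CriticalPhenomena-11385-s1-0` (STRATEGY-CENSUS §Decomposition),
route `CardyComplexCone`, sub-problem `CriticalPhenomena/CardyFormulaZ2`; landed verbatim (docstrings added) by the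
line lead `prover-line-stmt-CriticalPhenomena-11385-c2-0` as a helper file `--supports stmt-CriticalPhenomena-11385`
(tree copy of the source: `Cruxes/EdgeCoherence/HarmonicSplitGlue.lean`). Nothing here is asserted: the three pieces are
`def … : Prop` statements (objects the route posits, like the `Sig.stub_*` statements of
`Theorems/CardyComplexConeEdgeCoherenceLeeYangDefs.lean`), and every theorem is an unconditional implication between them
and the route's decls.

Write the four corner values of the spin-`1/3` corner observable at a primal vertex `v` as
`E_c(v) = E_δ(v, faceAt v c)`, classes `c = 0, 1, 2, 3` ↔ faces `v, v − e₀, v − e₀ − e₁, v − e₁`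
(offsets `0, −e₀, −e₀−e₁, −e₁`), and their `ℤ₄`-harmonics `H_k(v) = Σ_c i^{kc} E_c(v)`
(`FixedRadiusCut.harmonic`).  `EdgeCoherence` with the witness `u ≡ 1` is `H₁, H₂, H₃ = o(δ^{1/3})`
locally uniformly (`HarmonicVanishing`; the LANDED stub `stub_aliasing : HarmonicVanishing → EdgeCoherence`,
p87880).  This file proves that the crux follows from THREE typed pieces,

* `LatticeClassRegularity` — lattice-scale same-class regularity: the corner observable at a corner and
  at the same-class corner of a lattice NEIGHBOUR differ by `o(δ^{1/3})`, locally uniformly (the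
  lattice-scale case of clause (ii) of the sibling crux `EdgePrecompact`; `latticeClassRegularity_of_edgePrecompact`);
* `AlternatingModeNull` — the alternating (spin-`5/3`) mode `H₂(v) = E₀ − E₁ + E₂ − E₃ = o(δ^{1/3})`;
* `ChiralModeNull` — the chiral (spin-`2/3`) mode `H₁(v) = E₀ + iE₁ − E₂ − iE₃ = o(δ^{1/3})`,

by the glue `EdgeCoherence_of_subs : LatticeClassRegularity → AlternatingModeNull → ChiralModeNull → EdgeCoherence`.
The mathematical content of the glue is the SLAVING OF THE FOURTH HARMONIC by the known half of the
discrete Cauchy–Riemann equations: Kirchhoff's vertex relation `E(NW) − E(SE) = i (E(NE) − E(SW))`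
(Duminil-Copin 2012 Prop. 4 / Duminil-Copin–Smirnov 2012 Prop. 8.6 at `q = 1`, LANDED for the tree's
corner observable in family form as `FinitaryGreenPairing.stub_kirchhoff`, crux `CoherentMorera`) at
the single horizontal edge `s(v, v + e₀)` reads, in classes, `E₀(v) − E₂(v+e₀) = i (E₁(v+e₀) − E₃(v))`,
whence the EXACT identity

  `H₃(v) = (E₂(v+e₀) − E₂(v)) + i · (E₁(v+e₀) − E₁(v))`        (`harmonic_three_eq`)

— two same-class lattice gradients, so `LatticeClassRegularity` alone gives `H₃ = o(δ^{1/3})`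
(`slavedModeNull_of`).  The pieces are the regularity that `EdgePrecompact` (ii) already asserts, the
alternating mode (the ONLY piece the proved crux `CoherentMorera` consumes) and the chiral mode (the
numerically dominant alias, relative size `δ^{1/4}`, surplus to the assembly).

The companion file `Theorems/CardyComplexConeEdgeCoherenceHarmonicSplitMorera.lean` adds
`coherentMoreraConclusion_of_alternatingModeNull`: `AlternatingModeNull → EdgePrecompact →` both conclusions of
the proved crux `CoherentMorera` (the chiral mode is never used by the route's assembly).

References: H. Duminil-Copin, *Parafermionic observables and their applications*, arXiv:1208.3787, Prop. 4;
H. Duminil-Copin, S. Smirnov, *Conformal invariance of lattice models*, Clay Math. Proc. 15 (2012), §8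
(Prop. 8.6, Conj. 8.7); crux triage `Cruxes/EdgeCoherence/TRIAGE-r1-1.md` (identities (1)–(4)) and
`Theorems/EdgeCoherence/Negative/HalfCRHarmonics.lean` (the harmonic form of the relation).
-/

noncomputable section

namespace Summit.CriticalPhenomena.CardyFormulaZ2.Cruxes.EdgeCoherence.HarmonicSplit

open scoped BigOperators Topology
open Filter Set MeasureTheory
open Literature.Probability.LatticeModels Literature.Probability.RandomPlanarGeometry
open Literature.Probability.Percolation (BondConfig bondPercolation half)
open Summit.CriticalPhenomena.CardyFormulaZ2.Theses.CardyComplexCone (EdgeCoherence EdgePrecompact)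
open Summit.CriticalPhenomena.CardyFormulaZ2.Cruxes.EdgeCoherence.FixedRadiusCut
  (cornerObs harmonic HarmonicVanishing)
open Summit.CriticalPhenomena.CardyFormulaZ2.Cruxes.CoherentMorera.FinitaryGreenPairing
  (KirchhoffRel cornersAt Guards TestFn ScaledNull P0 P2 PV A2 del VertexPrecompactAt scaledNull_of_sub_of_or
   spinShift_of stub_pairingBound stub_kirchhoff stub_siteRegrouping stub_traceIdentity stub_precompactTransfer)
open Summit.CriticalPhenomena.CardyFormulaZ2.Cruxes.CoherentMorera.FinitaryGreenPairing.ModeSelection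
  (exists_bound_dbar_del scaledNull_of_small)

/-! ## The three pieces (route-item texts over `cornerObs`, definitionally the crux's `E δ v f`) -/

/-- **Piece 1: lattice-scale same-class regularity.** Along every discretisation family of every
Dobrushin domain, on every compact `K ⊂ D`, for every `ε > 0`, eventually in `δ`: for every lattice
site `v` over `K`, every lattice neighbour `w` of `v` and every corner offset `o ∈ {0,−e₀,−e₁,−e₀−e₁}`,
`‖E_δ(w, w+o) − E_δ(v, v+o)‖ ≤ ε δ^{1/3}` — same-class corner values at lattice neighbours agree to
`o(δ^{1/3})`.  The lattice-scale case of `EdgePrecompact` (ii) (`latticeClassRegularity_of_edgePrecompact`). -/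
def LatticeClassRegularity : Prop :=
  ∀ (D : DobrushinDomain) (Λ : ℝ → DiscreteDobrushin), (∀ δ, (Λ δ).Ω = D.carrier) →
    (∀ δ, (Λ δ).δ = δ) → (∀ᶠ δ in 𝓝[>] (0:ℝ), (Λ δ).IsZdAdmissible) →
    ∀ K : Set ℂ, IsCompact K → K ⊆ D.carrier → ∀ ε > (0:ℝ), ∀ᶠ δ in 𝓝[>] (0:ℝ),
      ∀ v w o : Site 2, IsCorner 0 o → (zdGraph 2).Adj v w → meshPoint δ v ∈ K →
        ‖cornerObs (Λ δ) δ w (w + o) - cornerObs (Λ δ) δ v (v + o)‖ ≤ ε * δ ^ ((1:ℝ) / 3)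

/-- **Piece 2: the alternating (spin-`5/3`) mode is null.** `H₂(v) = E₀ − E₁ + E₂ − E₃ = o(δ^{1/3})`. -/
def AlternatingModeNull : Prop :=
  ∀ (D : DobrushinDomain) (Λ : ℝ → DiscreteDobrushin), (∀ δ, (Λ δ).Ω = D.carrier) →
    (∀ δ, (Λ δ).δ = δ) → (∀ᶠ δ in 𝓝[>] (0:ℝ), (Λ δ).IsZdAdmissible) →
    ∀ K : Set ℂ, IsCompact K → K ⊆ D.carrier → ∀ ε > (0:ℝ), ∀ᶠ δ in 𝓝[>] (0:ℝ),
      ∀ v : Site 2, meshPoint δ v ∈ K →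
        ‖cornerObs (Λ δ) δ v v - cornerObs (Λ δ) δ v (v - Pi.single 0 1) +
            cornerObs (Λ δ) δ v (v - Pi.single 0 1 - Pi.single 1 1) -
            cornerObs (Λ δ) δ v (v - Pi.single 1 1)‖ ≤ ε * δ ^ ((1:ℝ) / 3)

/-- **Piece 3: the chiral (spin-`2/3`) mode is null.** `H₁(v) = E₀ + iE₁ − E₂ − iE₃ = o(δ^{1/3})`. -/
def ChiralModeNull : Prop :=
  ∀ (D : DobrushinDomain) (Λ : ℝ → DiscreteDobrushin), (∀ δ, (Λ δ).Ω = D.carrier) →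
    (∀ δ, (Λ δ).δ = δ) → (∀ᶠ δ in 𝓝[>] (0:ℝ), (Λ δ).IsZdAdmissible) →
    ∀ K : Set ℂ, IsCompact K → K ⊆ D.carrier → ∀ ε > (0:ℝ), ∀ᶠ δ in 𝓝[>] (0:ℝ),
      ∀ v : Site 2, meshPoint δ v ∈ K →
        ‖cornerObs (Λ δ) δ v v + Complex.I * cornerObs (Λ δ) δ v (v - Pi.single 0 1) -
            cornerObs (Λ δ) δ v (v - Pi.single 0 1 - Pi.single 1 1) -
            Complex.I * cornerObs (Λ δ) δ v (v - Pi.single 1 1)‖ ≤ ε * δ ^ ((1:ℝ) / 3)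

/-- The slaved (spin-`4/3`) mode is null, `H₃ = E₀ − iE₁ − E₂ + iE₃ = o(δ^{1/3})` (⟸ piece 1, `slavedModeNull_of`). -/
def SlavedModeNull : Prop :=
  ∀ (D : DobrushinDomain) (Λ : ℝ → DiscreteDobrushin), (∀ δ, (Λ δ).Ω = D.carrier) →
    (∀ δ, (Λ δ).δ = δ) → (∀ᶠ δ in 𝓝[>] (0:ℝ), (Λ δ).IsZdAdmissible) →
    ∀ K : Set ℂ, IsCompact K → K ⊆ D.carrier → ∀ ε > (0:ℝ), ∀ᶠ δ in 𝓝[>] (0:ℝ),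
      ∀ v : Site 2, meshPoint δ v ∈ K →
        ‖cornerObs (Λ δ) δ v v - Complex.I * cornerObs (Λ δ) δ v (v - Pi.single 0 1) -
            cornerObs (Λ δ) δ v (v - Pi.single 0 1 - Pi.single 1 1) +
            Complex.I * cornerObs (Λ δ) δ v (v - Pi.single 1 1)‖ ≤ ε * δ ^ ((1:ℝ) / 3)

/-! ## Lattice bookkeeping -/

/-- The first lattice basis vector `e₀ = (1, 0)` of `ℤ²`. -/
abbrev e₀ : Site 2 := Pi.single 0 1
/-- The second lattice basis vector `e₁ = (0, 1)` of `ℤ²`. -/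
abbrev e₁ : Site 2 := Pi.single 1 1

/-- The class-`1` face at `v` is `v − e₀`. -/
theorem faceAt_one' (v : Site 2) : faceAt v 1 = v - e₀ := by
  ext i; fin_cases i <;> simp [faceAt, cornerOff]

/-- The class-`2` face at `v` is `v − e₀ − e₁`. -/
theorem faceAt_two' (v : Site 2) : faceAt v 2 = v - e₀ - e₁ := by
  ext i; fin_cases i <;> simp [faceAt, cornerOff]

/-- The class-`3` face at `v` is `v − e₁`. -/
theorem faceAt_three' (v : Site 2) : faceAt v 3 = v - e₁ := by
  ext i; fin_cases i <;> simp [faceAt, cornerOff]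

/-- `0` is a corner of the face `o` iff `o` is one of the four class offsets `0, −e₀, −e₀−e₁, −e₁`. -/
theorem isCorner_zero_offset_iff (o : Site 2) :
    IsCorner 0 o ↔ (o = 0 ∨ o = -e₀ ∨ o = -e₀ - e₁ ∨ o = -e₁) := by
  constructor
  · intro h
    have h0 := h 0
    have h1 := h 1
    simp only [Pi.zero_apply] at h0 h1
    have key0 : o 0 = 0 ∨ o 0 = -1 := by omega
    have key1 : o 1 = 0 ∨ o 1 = -1 := by omega
    rcases key0 with a | a <;> rcases key1 with b | b
    · left; ext i; fin_cases i <;> simp [a, b]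
    · right; right; right; ext i; fin_cases i <;> simp [a, b]
    · right; left; ext i; fin_cases i <;> simp [a, b]
    · right; right; left; ext i; fin_cases i <;> simp [a, b]
  · rintro (rfl | rfl | rfl | rfl)
    all_goals intro i; fin_cases i <;> simp

/-- Translating a class offset: if `0` is a corner of `o` then `w` is a corner of `w + o`. -/
theorem isCorner_add_of_isCorner_zero {o : Site 2} (h : IsCorner 0 o) (w : Site 2) :
    IsCorner w (w + o) := by
  intro i
  rcases h i with hi | hi
  · left; simp only [Pi.add_apply, Pi.zero_apply] at hi ⊢; omega
  · right; simp only [Pi.add_apply, Pi.zero_apply] at hi ⊢; omega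

/-- The family-form corner function of the `CoherentMorera` vocabulary IS the datum-form `cornerObs`
(both are the crux's `E δ v f` by `rfl`). -/
theorem fgpCornerObs_apply (Λ : ℝ → DiscreteDobrushin) (δ : ℝ) (v f : Site 2) :
    Summit.CriticalPhenomena.CardyFormulaZ2.Cruxes.CoherentMorera.FinitaryGreenPairing.cornerObs Λ δ (v, f) =
      cornerObs (Λ δ) δ v f := by
  -- buildfix 2026-08-20: since the E-1 rebuild (CardyComplexConeDefs) the left side reads FermionicObservable's
  -- `winding` and the right side (`EdgeCoherenceDefs.cornerObs`) the `Polyline` copy — equal functions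
  -- (`MedialWindingBridge`), one constant after the pending Literature dedupe; unfold both and bridge.
  simp only [Summit.CriticalPhenomena.CardyFormulaZ2.Cruxes.CoherentMorera.FinitaryGreenPairing.cornerObs,
    Summit.CriticalPhenomena.CardyFormulaZ2.Cruxes.CoherentMorera.FinitaryGreenPairing.cornerPhase, cornerObs,
    Literature.Probability.LatticeModels.Polyline.winding_eq_winding']

/-- Kirchhoff's relation at the horizontal edge `s(x, x + e₀)`, unfolded on the corner table. -/
theorem kirchhoffRel_zero_iff (G : Site 2 × Site 2 → ℂ) (x : Site 2) :
    KirchhoffRel G x 0 ↔ G (x, x) - G (x + e₀, x - e₁) = Complex.I * (G (x + e₀, x) - G (x, x - e₁)) := by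
  simp [KirchhoffRel, cornersAt]

/-! ## The harmonics written out -/
/-- `i³ = −i`. -/
private theorem I_pow_three : Complex.I ^ 3 = -Complex.I := Complex.I_pow_three
/-- `i⁶ = −1`. -/
private theorem I_pow_six : Complex.I ^ 6 = -1 := by
  rw [show (6:ℕ) = 2 * 3 from rfl, pow_mul, Complex.I_sq]; norm_num
/-- `i⁹ = i`. -/
private theorem I_pow_nine : Complex.I ^ 9 = Complex.I := by
  rw [show (9:ℕ) = 4 * 2 + 1 from rfl, pow_succ, pow_mul, Complex.I_pow_four]; simp

/-- The chiral harmonic written out: `H₁(v) = E₀ + iE₁ − E₂ − iE₃`. -/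
theorem harmonic_one_eq (Λ : ℝ → DiscreteDobrushin) (δ : ℝ) (v : Site 2) :
    harmonic Λ δ 1 v = cornerObs (Λ δ) δ v v + Complex.I * cornerObs (Λ δ) δ v (v - e₀) -
      cornerObs (Λ δ) δ v (v - e₀ - e₁) - Complex.I * cornerObs (Λ δ) δ v (v - e₁) := by
  simp only [FixedRadiusCut.harmonic, Fin.sum_univ_four, Fin.val_zero, Fin.val_one, Fin.val_two,
    show ((3 : Fin 4) : ℕ) = 3 from rfl, Literature.Probability.Percolation.faceAt_zero, faceAt_one', faceAt_two',
    faceAt_three',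
    one_mul, pow_zero, pow_one, Complex.I_sq, I_pow_three]
  ring

/-- The alternating harmonic written out: `H₂(v) = E₀ − E₁ + E₂ − E₃`. -/
theorem harmonic_two_eq (Λ : ℝ → DiscreteDobrushin) (δ : ℝ) (v : Site 2) :
    harmonic Λ δ 2 v = cornerObs (Λ δ) δ v v - cornerObs (Λ δ) δ v (v - e₀) +
      cornerObs (Λ δ) δ v (v - e₀ - e₁) - cornerObs (Λ δ) δ v (v - e₁) := by
  simp only [FixedRadiusCut.harmonic, Fin.sum_univ_four, Fin.val_zero, Fin.val_one, Fin.val_two,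
    show ((3 : Fin 4) : ℕ) = 3 from rfl, Literature.Probability.Percolation.faceAt_zero, faceAt_one', faceAt_two',
    faceAt_three',
    mul_zero, mul_one, pow_zero, Complex.I_sq, show 2 * 2 = 4 from rfl, Complex.I_pow_four,
    show 2 * 3 = 6 from rfl, I_pow_six]
  ring

/-- The fourth harmonic written out: `H₃(v) = E₀ − iE₁ − E₂ + iE₃`. -/
theorem harmonic_three_expand (Λ : ℝ → DiscreteDobrushin) (δ : ℝ) (v : Site 2) :
    harmonic Λ δ 3 v = cornerObs (Λ δ) δ v v - Complex.I * cornerObs (Λ δ) δ v (v - e₀) -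
      cornerObs (Λ δ) δ v (v - e₀ - e₁) + Complex.I * cornerObs (Λ δ) δ v (v - e₁) := by
  simp only [FixedRadiusCut.harmonic, Fin.sum_univ_four, Fin.val_zero, Fin.val_one, Fin.val_two,
    show ((3 : Fin 4) : ℕ) = 3 from rfl, Literature.Probability.Percolation.faceAt_zero, faceAt_one', faceAt_two',
    faceAt_three',
    mul_zero, mul_one, pow_zero, I_pow_three, show 3 * 2 = 6 from rfl, I_pow_six,
    show 3 * 3 = 9 from rfl, I_pow_nine]
  ring

/-! ## The slaving identity -/

/-- **The slaving identity.** Under Kirchhoff's relation at the horizontal edge `s(v, v + e₀)` the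
fourth harmonic is an EXACT combination of two same-class lattice gradients:
`H₃(v) = (E₂(v+e₀) − E₂(v)) + i (E₁(v+e₀) − E₁(v))`. [cite: DuminilCopin2012Parafermion, Proposition 4] -/
theorem harmonic_three_eq (Λ : ℝ → DiscreteDobrushin) (δ : ℝ) (v : Site 2)
    (hK : KirchhoffRel
      (Summit.CriticalPhenomena.CardyFormulaZ2.Cruxes.CoherentMorera.FinitaryGreenPairing.cornerObs Λ δ) v 0) :
    harmonic Λ δ 3 v =
      (cornerObs (Λ δ) δ (v + e₀) (v + e₀ - e₀ - e₁) - cornerObs (Λ δ) δ v (v - e₀ - e₁)) +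
        Complex.I * (cornerObs (Λ δ) δ (v + e₀) (v + e₀ - e₀) - cornerObs (Λ δ) δ v (v - e₀)) := by
  rw [kirchhoffRel_zero_iff] at hK
  rw [fgpCornerObs_apply, fgpCornerObs_apply, fgpCornerObs_apply, fgpCornerObs_apply] at hK
  rw [harmonic_three_expand]
  have h1 : (v + e₀ - e₀ - e₁ : Site 2) = v - e₁ := by abel
  have h2 : (v + e₀ - e₀ : Site 2) = v := by abel
  rw [h1, h2]
  linear_combination hK

/-! ## Piece 1 slaves `H₃` -/

/-- The medial point of the edge `s(v, v + e₀)` is within `δ/2 ≤ ρ` of `δv` for `0 ≤ δ ≤ 2ρ`. -/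
theorem medialPoint_edge_mem_cthickening {K : Set ℂ} {ρ δ : ℝ} (hδ : 0 ≤ δ) (hδρ : δ ≤ ρ)
    {v : Site 2} (hv : meshPoint δ v ∈ K) :
    medialPoint δ s(v, v + Pi.single 0 1) ∈ Metric.cthickening ρ K := by
  refine Metric.mem_cthickening_of_dist_le _ (meshPoint δ v) _ _ hv ?_
  rw [medialPoint_mk, Complex.dist_eq]
  have : (meshPoint δ v + meshPoint δ (v + Pi.single 0 1)) / 2 - meshPoint δ v = ((δ / 2 : ℝ) : ℂ) := by
    apply Complex.ext
    · simp; ring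
    · simp
  rw [this, Complex.norm_real, Real.norm_eq_abs, abs_of_nonneg (by linarith)]
  linarith

/-- **Piece 1 ⇒ the slaved mode is null.** Kirchhoff's relation (landed, family form, eventually on a
compact thickening of `K` inside `D`) + the slaving identity + lattice-scale regularity at `ε/2`. -/
theorem slavedModeNull_of : LatticeClassRegularity → SlavedModeNull := by
  intro hR D Λ hΩ hδ hadm K hK hKD ε hε
  obtain ⟨ρ, hρ, hρD⟩ := hK.exists_cthickening_subset_open D.isOpen hKD
  have hK' : IsCompact (Metric.cthickening ρ K) := hK.cthickening
  have hKi := stub_kirchhoff D Λ ⟨hΩ, hδ, hadm⟩ _ hK' hρD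
  have hR' := hR D Λ hΩ hδ hadm K hK hKD (ε / 2) (half_pos hε)
  have hle : ∀ᶠ δ in 𝓝[>] (0:ℝ), δ ∈ Set.Ioc 0 ρ := Ioc_mem_nhdsGT hρ
  have hoff₁ : IsCorner 0 (-e₀ : Site 2) := (isCorner_zero_offset_iff _).2 (Or.inr (Or.inl rfl))
  have hoff₂ : IsCorner 0 (-e₀ - e₁ : Site 2) := (isCorner_zero_offset_iff _).2 (Or.inr (Or.inr (Or.inl rfl)))
  filter_upwards [hKi, hR', hle] with δ hKiδ hRδ hδI v hv
  have hmed := medialPoint_edge_mem_cthickening (K := K) hδI.1.le hδI.2 hv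
  have hk := hKiδ v 0 hmed
  have hδ3 : (0:ℝ) ≤ δ ^ ((1:ℝ) / 3) := Real.rpow_nonneg hδI.1.le _
  have hA := hRδ v (v + e₀) (-e₀ - e₁) hoff₂ ((zdGraph_adj_iff _ _).2 ⟨0, Or.inl rfl⟩) hv
  have hB := hRδ v (v + e₀) (-e₀) hoff₁ ((zdGraph_adj_iff _ _).2 ⟨0, Or.inl rfl⟩) hv
  have eA1 : (v + e₀ + (-e₀ - e₁) : Site 2) = v + e₀ - e₀ - e₁ := by abel
  have eA2 : (v + (-e₀ - e₁) : Site 2) = v - e₀ - e₁ := by abel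
  have eB1 : (v + e₀ + -e₀ : Site 2) = v + e₀ - e₀ := by abel
  have eB2 : (v + -e₀ : Site 2) = v - e₀ := by abel
  rw [eA1, eA2] at hA
  rw [eB1, eB2] at hB
  rw [← harmonic_three_expand, harmonic_three_eq Λ δ v hk]
  calc ‖(cornerObs (Λ δ) δ (v + e₀) (v + e₀ - e₀ - e₁) - cornerObs (Λ δ) δ v (v - e₀ - e₁)) +
          Complex.I * (cornerObs (Λ δ) δ (v + e₀) (v + e₀ - e₀) - cornerObs (Λ δ) δ v (v - e₀))‖
      ≤ ‖cornerObs (Λ δ) δ (v + e₀) (v + e₀ - e₀ - e₁) - cornerObs (Λ δ) δ v (v - e₀ - e₁)‖ +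
          ‖Complex.I * (cornerObs (Λ δ) δ (v + e₀) (v + e₀ - e₀) - cornerObs (Λ δ) δ v (v - e₀))‖ :=
        norm_add_le _ _
    _ = ‖cornerObs (Λ δ) δ (v + e₀) (v + e₀ - e₀ - e₁) - cornerObs (Λ δ) δ v (v - e₀ - e₁)‖ +
          ‖cornerObs (Λ δ) δ (v + e₀) (v + e₀ - e₀) - cornerObs (Λ δ) δ v (v - e₀)‖ := by
        rw [norm_mul, Complex.norm_I, one_mul]
    _ ≤ ε / 2 * δ ^ ((1:ℝ) / 3) + ε / 2 * δ ^ ((1:ℝ) / 3) := add_le_add hA hB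
    _ = ε * δ ^ ((1:ℝ) / 3) := by ring

/-! ## The three harmonics give `HarmonicVanishing`, hence the crux -/

/-- `HarmonicVanishing` from the nullity of the three alias modes. -/
theorem harmonicVanishing_of (h1 : ChiralModeNull) (h2 : AlternatingModeNull) (h3 : SlavedModeNull) :
    HarmonicVanishing := by
  intro D Λ hΩ hδ hadm K hK hKD ε hε
  filter_upwards [h1 D Λ hΩ hδ hadm K hK hKD ε hε, h2 D Λ hΩ hδ hadm K hK hKD ε hε,
    h3 D Λ hΩ hδ hadm K hK hKD ε hε] with δ h1δ h2δ h3δ v hv k hk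
  simp only [Finset.mem_insert, Finset.mem_singleton] at hk
  rcases hk with rfl | rfl | rfl
  · rw [harmonic_one_eq]; exact h1δ v hv
  · rw [harmonic_two_eq]; exact h2δ v hv
  · rw [harmonic_three_expand]; exact h3δ v hv

/-- **The glue of the split: `EdgeCoherence` from the three pieces** (piece 1 slaves `H₃`; the landed
`stub_aliasing` turns the three alias harmonics into the crux with `u ≡ 1`).
[cite: DuminilCopinSmirnov2012Lattice, Conjecture 8.7] -/
theorem EdgeCoherence_of_subs : LatticeClassRegularity → AlternatingModeNull → ChiralModeNull → EdgeCoherence :=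
  fun hR h2 h1 =>
    Summit.CriticalPhenomena.CardyFormulaZ2.Cruxes.EdgeCoherence.FixedRadiusCut.stub_aliasing
      (harmonicVanishing_of h1 h2 (slavedModeNull_of hR))

/-! ## Piece 1 is the lattice-scale case of `EdgePrecompact` (ii) -/

/-- `EdgePrecompact` read over `cornerObs` (definitional). -/
theorem edgePrecompact_iff_cornerObs :
    EdgePrecompact ↔
      ∀ (D : DobrushinDomain) (Λ : ℝ → DiscreteDobrushin), (∀ δ, (Λ δ).Ω = D.carrier) →
        (∀ δ, (Λ δ).δ = δ) → (∀ᶠ δ in 𝓝[>] (0:ℝ), (Λ δ).IsZdAdmissible) →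
        ∀ K : Set ℂ, IsCompact K → K ⊆ D.carrier →
          (∃ C : ℝ, ∀ᶠ δ in 𝓝[>] (0:ℝ), ∀ v f : Site 2, IsCorner v f → meshPoint δ v ∈ K →
            ‖cornerObs (Λ δ) δ v f‖ ≤ C * δ ^ ((1:ℝ) / 3)) ∧
          (∀ ε > (0:ℝ), ∃ η > (0:ℝ), ∀ᶠ δ in 𝓝[>] (0:ℝ), ∀ v f v' f' : Site 2,
            IsCorner v f → IsCorner v' f' → f - v = f' - v' → meshPoint δ v ∈ K →
              meshPoint δ v' ∈ K → dist (meshPoint δ v) (meshPoint δ v') < η →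
                ‖cornerObs (Λ δ) δ v f - cornerObs (Λ δ) δ v' f'‖ ≤ ε * δ ^ ((1:ℝ) / 3)) := by
  -- no longer `Iff.rfl`: `EdgePrecompact` spells `LatticeModels.winding`, `cornerObs` spells
  -- `Polyline.winding` (equal by `Polyline.winding_eq_winding'`, not definitionally)
  simp only [cornerObs, Literature.Probability.LatticeModels.Polyline.winding_eq_winding']
  exact Iff.rfl

/-- **`EdgePrecompact → LatticeClassRegularity`**: clause (ii) on a compact thickening of `K` inside
`D`, at pairs of lattice neighbours (distance `δ < η`). -/
theorem latticeClassRegularity_of_edgePrecompact : EdgePrecompact → LatticeClassRegularity := by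
  intro hP D Λ hΩ hδ hadm K hK hKD ε hε
  obtain ⟨ρ, hρ, hρD⟩ := hK.exists_cthickening_subset_open D.isOpen hKD
  have hK' : IsCompact (Metric.cthickening ρ K) := hK.cthickening
  obtain ⟨η, hη, hev⟩ := ((edgePrecompact_iff_cornerObs.1 hP) D Λ hΩ hδ hadm _ hK' hρD).2 ε hε
  have hle : ∀ᶠ δ in 𝓝[>] (0:ℝ), δ ∈ Set.Ioc 0 (min ρ (η / 2)) :=
    Ioc_mem_nhdsGT (lt_min hρ (half_pos hη))
  filter_upwards [hev, hle] with δ hevδ hδI v w o ho hvw hv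
  have hδρ : δ ≤ ρ := hδI.2.trans (min_le_left _ _)
  have hδη : δ < η := lt_of_le_of_lt (hδI.2.trans (min_le_right _ _)) (by linarith)
  have hdist : dist (meshPoint δ w) (meshPoint δ v) ≤ δ := by
    rw [dist_comm]; exact Literature.Probability.LatticeModels.Polyomino.dist_meshPoint_le_of_adj hδI.1.le hvw
  have hvK' : meshPoint δ v ∈ Metric.cthickening ρ K := Metric.self_subset_cthickening _ hv
  have hwK' : meshPoint δ w ∈ Metric.cthickening ρ K :=
    Metric.mem_cthickening_of_dist_le _ _ _ _ hv (hdist.trans hδρ)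
  exact hevδ w (w + o) v (v + o) (isCorner_add_of_isCorner_zero ho w) (isCorner_add_of_isCorner_zero ho v)
    (by abel) hwK' hvK' (lt_of_le_of_lt hdist hδη)

/-- Given the route's crux `EdgePrecompact`, `EdgeCoherence` is exactly the two modes. -/
theorem EdgeCoherence_of_edgePrecompact_of_modes : EdgePrecompact → AlternatingModeNull → ChiralModeNull → EdgeCoherence :=
  fun hP h2 h1 => EdgeCoherence_of_subs (latticeClassRegularity_of_edgePrecompact hP) h2 h1

end Summit.CriticalPhenomena.CardyFormulaZ2.Cruxes.EdgeCoherence.HarmonicSplit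

end
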